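import Mathlib
import Summits.Ventures.FusionMHD.Models.TearingFRS1Coeffs2
import Literature.Analysis.ODE.RationalTaylorMajorant
import HarnessLib

/-!
# F3.r3 instance «TearingFRS1»: the structure of the local coefficient `q` — partial fractions, a SHARP
# geometric majorant of its Taylor data, and the sharp operator bound `‖M_k‖ ≤ 6.11 · 1.3ᵏ`

Companion of `TearingFRS1.lean` … `TearingFRS1Coeffs2.lean` (instance card `models/F3-SCOPING.md` §7, model-6).
`TearingFRS1.lean` proved `|qc k| ≤ (49/5)·8ᵏ` from the crude denominator margin at `ρ = 1/8`; that rate makes the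
Frobenius patch usable only on `|x| < 1/512`. The true radius of `q(x) = −4x/(1+x)² − 560/((3x²+6x+10)²(x+2))` is
`1`, and its Taylor coefficients have the EXACT structure

  `qc n = 4n(−1)ⁿ − (14/5)(−1/2)ⁿ + e_n`,   `e = ratTaylorCoeff P_E Q_E`,
  `E(x) = P_E/Q_E = (84x/25 + 126x²/125 + 63x³/125)/(1 + 3x/5 + 3x²/10)²`  (analytic on `|x| < √(10/3)`),

(partial fractions: `−560/((3x²+6x+10)²(x+2)) = −(14/5)/(1 + x/2) + E(x)`, `E = (84/5)·x(3x²+6x+20)/(3x²+6x+10)²`).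
This file proves that structure and draws the two consequences the certificate needs:

* `q_partial_fractions`, `hasSum_geomPart`, `hasSum_ec`, **`qc_decomp`** (the identity above, for every `n`; proved
  by uniqueness of power-series coefficients on the disc `|x| < 1/8` from `q_taylor`);
* `norm_ec_le : |e_n| ≤ 11 · (5/4)ⁿ` — by the PRECONDITIONED margin (`norm_ratTaylorCoeff_le_precond` with the
  degree-8 preconditioner `V = Q_E^{-1/2}`-type polynomial `V ≈ (1 + 3x/5 + 3x²/10)⁻¹ mod x⁹`: the pair
  `(P_E V, Q_E V)` has margin `≤ 0.673` and numerator sum `≤ 3.564` at `ρ = 4/5`), where the plain margin of `Q_E`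
  fails beyond `ρ ≈ 0.42`;
* `norm_qc_le_sharp : |qc k| ≤ 30·(5/4)ᵏ` (hence the WIDE local data `IsScalarLogData pc qc p q (5/4) 30 (4/5)`,
  `isScalarLogData_wide`, with `hasSum_q` now on `|x| < 4/5`), and THE HYBRID OPERATOR BOUND
  **`norm_Msys_le_sharp : ‖M_k‖ ≤ (611/100)·(13/10)ᵏ`** (`k ≥ 1`; exact values for `k < 20`, the structure beyond) — the
  input of the jet lemma that certifies the patch out to `|x| < 10/19` (`TearingFRS1Jets2.lean`).

All numbers were generated in exact rational arithmetic (seat script `work/proto/patch_design.py`) and are re-derived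
by the kernel. [instance data]
-/

noncomputable section

open Finset Filter Polynomial Literature.Analysis.ODE
open scoped Topology NNReal

namespace Summit.Ventures.FusionMHD.Models

namespace TearingFRS1

/-! ### The analytic part `E = P_E/Q_E` and its preconditioner -/

/-- Numerator `P_E = (84/25)x + (126/125)x² + (63/125)x³` of `E`. [instance data] -/
def PE : ℝ[X] := C (84 / 25) * X + C (126 / 125) * X ^ 2 + C (63 / 125) * X ^ 3

/-- Denominator `Q_E = (1 + 3x/5 + 3x²/10)² = 1 + (6/5)x + (24/25)x² + (9/25)x³ + (9/100)x⁴` of `E`. [instance data] -/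
def QE : ℝ[X] := 1 + C (6 / 5) * X + C (24 / 25) * X ^ 2 + C (9 / 25) * X ^ 3 + C (9 / 100) * X ^ 4

/-- The preconditioner `V = (1 + 3x/5 + 3x²/10)⁻¹ mod x⁹` (exact Taylor polynomial). [instance data] -/
def V : ℝ[X] := 1 + C (-3 / 5) * X + C (3 / 50) * X ^ 2 + C (18 / 125) * X ^ 3 + C (-261 / 2500) * X ^ 4
  + C (243 / 12500) * X ^ 5 + C (2457 / 125000) * X ^ 6 + C (-1377 / 78125) * X ^ 7 + C (29241 / 6250000) * X ^ 8

/-- `Q_E V`, expanded: `1 + 3x/5 + 3x²/10 + O(x⁹)` (four tail terms). [instance data] -/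
def QEV : ℝ[X] := 1 + C (3 / 5) * X + C (3 / 10) * X ^ 2 + C (-77517 / 31250000) * X ^ 9
  + C (-26487 / 312500000) * X ^ 10 + C (15309 / 156250000) * X ^ 11 + C (263169 / 625000000) * X ^ 12

/-- `P_E V`, expanded (degree `11`). [instance data] -/
def PEV : ℝ[X] := C (84 / 25) * X + C (-126 / 125) * X ^ 2 + C (63 / 625) * X ^ 3 + C (756 / 3125) * X ^ 4
  + C (-5481 / 31250) * X ^ 5 + C (5103 / 156250) * X ^ 6 + C (51597 / 1562500) * X ^ 7
  + C (-57834 / 1953125) * X ^ 8 + C (614061 / 78125000) * X ^ 9 + C (-1627857 / 390625000) * X ^ 10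
  + C (1842183 / 781250000) * X ^ 11

/-- `Q_E · V = QEV` (polynomial identity, checked by evaluation). [instance data] -/
theorem QE_mul_V : QE * V = QEV := by
  refine Polynomial.funext fun r => ?_
  simp only [QE, V, QEV, eval_add, eval_mul, eval_C, eval_X, eval_pow, eval_one]
  ring

/-- `P_E · V = PEV`. [instance data] -/
theorem PE_mul_V : PE * V = PEV := by
  refine Polynomial.funext fun r => ?_
  simp only [PE, V, PEV, eval_add, eval_mul, eval_C, eval_X, eval_pow, eval_one]
  ring

/-- `Q_E(0) = 1`. [instance data] -/
theorem QE_coeff_zero : QE.coeff 0 = 1 := by simp [QE]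

/-- `V(0) = 1`. [instance data] -/
theorem V_coeff_zero : V.coeff 0 = 1 := by simp [V]

/-- `deg (Q_E V) ≤ 12`. [instance data] -/
theorem QEV_natDegree_le : (QE * V).natDegree ≤ 12 := by rw [QE_mul_V]; unfold QEV; compute_degree

/-- `deg (P_E V) ≤ 11`. [instance data] -/
theorem PEV_natDegree_le : (PE * V).natDegree ≤ 11 := by rw [PE_mul_V]; unfold PEV; compute_degree

/-- PRECONDITIONED MARGIN: `Σ_{1≤j≤12} |(Q_E V)_j| (4/5)ʲ ≤ 673/1000` (exact value `0.67237…`). [instance data] -/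
theorem QEV_margin : ∑ j ∈ range 12, ‖(QE * V).coeff (j + 1)‖ * (4 / 5 : ℝ) ^ (j + 1) ≤ 673 / 1000 := by
  rw [QE_mul_V]
  simp only [QEV, Finset.sum_range_succ, Finset.sum_range_zero, coeff_add, coeff_C_mul, coeff_X_pow, coeff_one,
    coeff_X]
  norm_num

/-- numerator sum: `Σ_{i≤11} |(P_E V)_i| (4/5)ⁱ ≤ 891/250` (exact value `3.5634…`). [instance data] -/
theorem PEV_sum : ∑ i ∈ range (11 + 1), ‖(PE * V).coeff i‖ * (4 / 5 : ℝ) ^ i ≤ 891 / 250 := by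
  rw [PE_mul_V]
  simp only [PEV, Finset.sum_range_succ, Finset.sum_range_zero, coeff_add, coeff_C_mul, coeff_X_pow, coeff_X]
  norm_num

/-- The Taylor coefficients `e_n` of `E = P_E/Q_E`. [instance data] -/
def ec : ℕ → ℝ := ratTaylorCoeff PE QE

/-- **SHARP MAJORANT OF THE ANALYTIC PART**: `|e_n| ≤ 11 · (5/4)ⁿ` (`S/(1 − θ) = (891/250)/(327/1000) ≤ 11`).
[instance data] -/
theorem norm_ec_le (n : ℕ) : ‖ec n‖ ≤ 11 * (5 / 4 : ℝ) ^ n := by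
  have h := norm_ratTaylorCoeff_le_precond PE QE QE_coeff_zero V_coeff_zero (ρ := 4 / 5) (by norm_num)
    QEV_natDegree_le PEV_natDegree_le QEV_margin (by norm_num) PEV_sum n
  rw [show ((4 : ℝ) / 5)⁻¹ = 5 / 4 by norm_num] at h
  exact h.trans (mul_le_mul_of_nonneg_right (by norm_num) (by positivity))

/-- `E` as a power series: `Σ xⁿ e_n = P_E(x)/Q_E(x)` for `|x| < 4/5` (through the preconditioned pair, whose
margin holds up to `ρ = 4/5`; the plain margin of `Q_E` would stop at `ρ ≈ 0.42`). [instance data] -/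
theorem hasSum_ec {x : ℝ} (hx : ‖x‖ < 4 / 5) : HasSum (fun n => x ^ n * ec n) (PE.eval x / QE.eval x) := by
  have hQ : (QE * V).coeff 0 = 1 := by rw [Polynomial.mul_coeff_zero, QE_coeff_zero, V_coeff_zero, one_mul]
  obtain ⟨hne, hsum⟩ := (ratTaylor_of_natDegree_le (PE * V) (QE * V) hQ (by norm_num : (0 : ℝ) < 4 / 5)
    QEV_natDegree_le PEV_natDegree_le QEV_margin (by norm_num) PEV_sum).2 x hx
  have hV : V.eval x ≠ 0 := by
    rw [eval_mul] at hne
    exact right_ne_zero_of_mul hne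
  have e1 : (fun n => x ^ n * ratTaylorCoeff (PE * V) (QE * V) n) = fun n => x ^ n * ec n := by
    funext n; rw [ratTaylorCoeff_mul_right PE QE QE_coeff_zero V_coeff_zero n, ec]
  have e2 : (PE * V).eval x / (QE * V).eval x = PE.eval x / QE.eval x := by
    rw [eval_mul, eval_mul, mul_div_mul_right _ _ hV]
  rwa [e1, e2] at hsum

/-! ### The partial-fraction structure of `q` -/

/-- PARTIAL FRACTIONS: `q(x) = −4x/(1+x)² − (14/5)/(1 + x/2) + P_E(x)/Q_E(x)` away from `x ∈ {−1, −2}`. [instance data] -/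
theorem q_partial_fractions {x : ℝ} (hx1 : 1 + x ≠ 0) (hx2 : x + 2 ≠ 0) :
    q x = -4 * x / (1 + x) ^ 2 - 14 / 5 / (1 + x / 2) + PE.eval x / QE.eval x := by
  have h3 : (3 * x ^ 2 + 6 * x + 10 : ℝ) ≠ 0 := by nlinarith [sq_nonneg (x + 1)]
  have h2x : (2 : ℝ) + x ≠ 0 := by rwa [add_comm] at hx2
  have hQE : QE.eval x = (3 * x ^ 2 + 6 * x + 10) ^ 2 / 100 := by
    simp only [QE, eval_add, eval_mul, eval_C, eval_X, eval_pow, eval_one]; ring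
  have hPE : PE.eval x = 84 / 5 * x * ((3 * x ^ 2 + 6 * x + 10) + 10) / 100 := by
    simp only [PE, eval_add, eval_mul, eval_C, eval_X, eval_pow]; ring
  rw [q_eq hx1 hx2, hQE, hPE, show (1 + x / 2 : ℝ) = (2 + x) / 2 by ring]
  set t : ℝ := 3 * x ^ 2 + 6 * x + 10 with ht
  field_simp
  rw [ht]
  ring

/-- The two geometric parts as power series on `|x| < 1`:
`Σ xⁿ (4n(−1)ⁿ − (14/5)(−1/2)ⁿ) = −4x/(1+x)² − (14/5)/(1 + x/2)`. [instance data] -/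
theorem hasSum_geomPart {x : ℝ} (hx : ‖x‖ < 1) :
    HasSum (fun n : ℕ => x ^ n * (4 * (n : ℝ) * (-1) ^ n - 14 / 5 * (-1 / 2) ^ n))
      (-4 * x / (1 + x) ^ 2 - 14 / 5 / (1 + x / 2)) := by
  have h1 : HasSum (fun n : ℕ => (n : ℝ) * (-x) ^ n) ((-x) / (1 - (-x)) ^ 2) :=
    hasSum_coe_mul_geometric_of_norm_lt_one (by rwa [norm_neg])
  have h2 : HasSum (fun n : ℕ => (-x / 2) ^ n) (1 - (-x / 2))⁻¹ := by
    refine hasSum_geometric_of_norm_lt_one ?_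
    rw [norm_div, norm_neg, Real.norm_ofNat]
    linarith
  have h := (h1.mul_left 4).sub (h2.mul_left (14 / 5))
  have e1 : (1 - -x : ℝ) = 1 + x := by ring
  have e2 : (1 - -x / 2 : ℝ) = 1 + x / 2 := by ring
  have ev : 4 * (-x / (1 - -x) ^ 2) - 14 / 5 * (1 - -x / 2)⁻¹ = -4 * x / (1 + x) ^ 2 - 14 / 5 / (1 + x / 2) := by
    rw [e1, e2, div_eq_mul_inv (14 / 5 : ℝ)]
    ring
  have ef : (fun n : ℕ => x ^ n * (4 * (n : ℝ) * (-1) ^ n - 14 / 5 * (-1 / 2) ^ n)) =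
      fun n : ℕ => 4 * ((n : ℝ) * (-x) ^ n) - 14 / 5 * (-x / 2) ^ n := by
    funext n
    rw [show (-x / 2 : ℝ) = (-1 / 2) * x by ring, mul_pow, neg_pow x n]
    ring
  rw [ef, ← ev]
  exact h

/-- `‖A − B + C‖ ≤ ‖A‖ + ‖B‖ + ‖C‖`. [folklore] -/
theorem norm_sub_add_le₃ (A B C : ℝ) : ‖A - B + C‖ ≤ ‖A‖ + ‖B‖ + ‖C‖ := by
  calc ‖A - B + C‖ ≤ ‖A - B‖ + ‖C‖ := norm_add_le _ _
    _ ≤ ‖A‖ + ‖B‖ + ‖C‖ := by linarith [norm_sub_le A B]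

/-- Uniqueness of power-series coefficients (scalar case): two geometrically bounded coefficient sequences whose
series agree on a neighbourhood of `0` are equal. [folklore] -/
theorem coeff_eq_of_tsum_eq {a b : ℕ → ℝ} {Ba la Bb lb r : ℝ} (ha : ∀ n, ‖a n‖ ≤ Ba * la ^ n) (hla : 0 ≤ la)
    (hb : ∀ n, ‖b n‖ ≤ Bb * lb ^ n) (hlb : 0 ≤ lb) (hr : 0 < r)
    (h : ∀ x : ℝ, ‖x‖ < r → (∑' n, x ^ n • a n) = ∑' n, x ^ n • b n) (n : ℕ) : a n = b n := by
  set ρ : ℝ := min r (1 / (la + lb + 1)) with hρ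
  have hρ0 : 0 < ρ := lt_min hr (by positivity)
  have hρr : ρ ≤ r := min_le_left _ _
  have hρ1 : ρ ≤ 1 / (la + lb + 1) := min_le_right _ _
  set r₀ : ℝ≥0 := ⟨ρ, hρ0.le⟩ with hr₀
  have hr₀0 : 0 < r₀ := hρ0
  have hcoe : (r₀ : ℝ) = ρ := rfl
  have hla' : la * r₀ ≤ 1 := by
    rw [hcoe]
    calc la * ρ ≤ la * (1 / (la + lb + 1)) := mul_le_mul_of_nonneg_left hρ1 hla
      _ ≤ 1 := by rw [mul_one_div, div_le_one (by positivity)]; linarith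
  have hlb' : lb * r₀ ≤ 1 := by
    rw [hcoe]
    calc lb * ρ ≤ lb * (1 / (la + lb + 1)) := mul_le_mul_of_nonneg_left hρ1 hlb
      _ ≤ 1 := by rw [mul_one_div, div_le_one (by positivity)]; linarith
  have hPa := hasFPowerSeriesOnBall_tsum_pow_smul (𝕜 := ℝ) ha hla hr₀0 hla'
  have hPb := hasFPowerSeriesOnBall_tsum_pow_smul (𝕜 := ℝ) hb hlb hr₀0 hlb'
  have heq : coeffSeries (𝕜 := ℝ) b = coeffSeries a := by
    refine hPb.hasFPowerSeriesAt.eq_formalMultilinearSeries (hPa.hasFPowerSeriesAt.congr ?_)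
    filter_upwards [Metric.ball_mem_nhds (0 : ℝ) hρ0] with x hx
    rw [Metric.mem_ball, dist_zero_right] at hx
    exact h x (hx.trans_le hρr)
  have := congrArg (fun p : FormalMultilinearSeries ℝ ℝ ℝ => p.coeff n) heq
  simpa only [coeffSeries_coeff] using this.symm

/-- **THE DECOMPOSITION OF THE `q`-DATA**: `qc n = 4n(−1)ⁿ − (14/5)(−1/2)ⁿ + e_n` for every `n`. [instance data] -/
theorem qc_decomp (n : ℕ) : qc n = 4 * (n : ℝ) * (-1) ^ n - 14 / 5 * (-1 / 2) ^ n + ec n := by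
  -- crude geometric bounds for both sequences
  have hqc : ∀ k, ‖qc k‖ ≤ (21 / 5) / (1 - 4 / 7) * (8 : ℝ) ^ k := fun k => by
    have h := q_taylor.1 k
    rwa [show ((1 : ℝ) / 8)⁻¹ = 8 by norm_num] at h
  have hd : ∀ k : ℕ, ‖4 * (k : ℝ) * (-1) ^ k - 14 / 5 * (-1 / 2) ^ k + ec k‖ ≤ 18 * (2 : ℝ) ^ k := fun k => by
    have hk : (k : ℝ) ≤ 2 ^ k := by exact_mod_cast (Nat.lt_two_pow_self (n := k)).le
    have h54 : (5 / 4 : ℝ) ^ k ≤ 2 ^ k := pow_le_pow_left₀ (by norm_num) (by norm_num) k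
    have hhalf : ‖(-1 / 2 : ℝ) ^ k‖ ≤ 1 := by rw [norm_pow]; exact pow_le_one₀ (norm_nonneg _) (by norm_num)
    have h1 : (1 : ℝ) ≤ 2 ^ k := one_le_pow₀ (by norm_num)
    have hA : ‖4 * (k : ℝ) * (-1) ^ k‖ = 4 * k := by
      rw [norm_mul, norm_mul, norm_pow, norm_neg, norm_one, one_pow, mul_one, Real.norm_ofNat, Real.norm_natCast]
    have hB : ‖14 / 5 * (-1 / 2 : ℝ) ^ k‖ ≤ 14 / 5 := by
      rw [norm_mul, Real.norm_of_nonneg (by norm_num : (0 : ℝ) ≤ 14 / 5)]; nlinarith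
    have hC := norm_ec_le k
    calc ‖4 * (k : ℝ) * (-1) ^ k - 14 / 5 * (-1 / 2) ^ k + ec k‖
        ≤ ‖4 * (k : ℝ) * (-1) ^ k‖ + ‖14 / 5 * (-1 / 2 : ℝ) ^ k‖ + ‖ec k‖ := norm_sub_add_le₃ _ _ _
      _ ≤ 18 * 2 ^ k := by rw [hA]; nlinarith
  refine coeff_eq_of_tsum_eq hqc (by norm_num) hd (by norm_num) (r := 1 / 8) (by norm_num) (fun x hx => ?_) n
  have hx1 : ‖x‖ < 1 := hx.trans (by norm_num)
  have hx45 : ‖x‖ < 4 / 5 := hx.trans (by norm_num)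
  have hx' : |x| < 1 / 8 := by simpa [Real.norm_eq_abs] using hx
  have hxa : 1 + x ≠ 0 := by intro h; rw [abs_lt] at hx'; linarith
  have hxb : x + 2 ≠ 0 := by intro h; rw [abs_lt] at hx'; linarith
  have hS1 : HasSum (fun k : ℕ => x ^ k * qc k) (q x) := isScalarLogData.hasSum_q x hx
  have hS2 : HasSum (fun k : ℕ => x ^ k * (4 * (k : ℝ) * (-1) ^ k - 14 / 5 * (-1 / 2) ^ k + ec k)) (q x) := by
    have h := (hasSum_geomPart hx1).add (hasSum_ec hx45)
    rw [← q_partial_fractions hxa hxb] at h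
    have ef : (fun k : ℕ => x ^ k * (4 * (k : ℝ) * (-1) ^ k - 14 / 5 * (-1 / 2) ^ k + ec k)) =
        fun k : ℕ => x ^ k * (4 * (k : ℝ) * (-1) ^ k - 14 / 5 * (-1 / 2) ^ k) + x ^ k * ec k := by
      funext k; ring
    rw [ef]
    exact h
  simp only [smul_eq_mul]
  rw [hS1.tsum_eq, hS2.tsum_eq]

/-! ### Consequences: the wide local data and the sharp operator bound -/

/-- `k ≤ 4·(5/4)ᵏ` (Bernoulli). [folklore] -/
theorem natCast_le_four_mul_pow (k : ℕ) : (k : ℝ) ≤ 4 * (5 / 4 : ℝ) ^ k := by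
  have h : 1 + (k : ℝ) * (1 / 4) ≤ (1 + 1 / 4) ^ k :=
    one_add_mul_le_pow (by norm_num) k
  rw [show (1 + 1 / 4 : ℝ) = 5 / 4 by norm_num] at h
  linarith [show (0 : ℝ) ≤ (5 / 4 : ℝ) ^ k from by positivity]

/-- SHARPER TAYLOR BOUND for `q`: `|qc k| ≤ 30 · (5/4)ᵏ` for all `k` (vs `(49/5)·8ᵏ` in `TearingFRS1.lean`).
[instance data] -/
theorem norm_qc_le_sharp (k : ℕ) : ‖qc k‖ ≤ 30 * (5 / 4 : ℝ) ^ k := by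
  rw [qc_decomp k]
  have hk := natCast_le_four_mul_pow k
  have hhalf : ‖(-1 / 2 : ℝ) ^ k‖ ≤ 1 := by rw [norm_pow]; exact pow_le_one₀ (norm_nonneg _) (by norm_num)
  have h1 : (1 : ℝ) ≤ (5 / 4) ^ k := one_le_pow₀ (by norm_num)
  have h0 : (0 : ℝ) ≤ (5 / 4) ^ k := by positivity
  have hA : ‖4 * (k : ℝ) * (-1) ^ k‖ = 4 * k := by
    rw [norm_mul, norm_mul, norm_pow, norm_neg, norm_one, one_pow, mul_one, Real.norm_ofNat, Real.norm_natCast]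
  have hB : ‖14 / 5 * (-1 / 2 : ℝ) ^ k‖ ≤ 14 / 5 := by
    rw [norm_mul, Real.norm_of_nonneg (by norm_num : (0 : ℝ) ≤ 14 / 5)]; nlinarith
  have hC := norm_ec_le k
  calc ‖4 * (k : ℝ) * (-1) ^ k - 14 / 5 * (-1 / 2) ^ k + ec k‖
      ≤ ‖4 * (k : ℝ) * (-1) ^ k‖ + ‖14 / 5 * (-1 / 2 : ℝ) ^ k‖ + ‖ec k‖ := norm_sub_add_le₃ _ _ _
    _ ≤ 30 * (5 / 4) ^ k := by rw [hA]; nlinarith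

/-- `Q(x) ≠ 0` on `|x| < 4/5` (needed for `p`, `q` as functions there). [instance data] -/
theorem one_add_ne_zero_of_lt {x : ℝ} (hx : ‖x‖ < 4 / 5) : 1 + x ≠ 0 ∧ x + 2 ≠ 0 := by
  rw [Real.norm_eq_abs, abs_lt] at hx
  constructor <;> intro h <;> linarith

/-- **THE WIDE LOCAL DATA**: `IsScalarLogData pc qc p q (5/4) 30 (4/5)` — the hypotheses of the logarithmic-branch
theorems now with rate `a = 5/4` and the coefficient functions summed on `|x| < 4/5`. [instance data] -/
theorem isScalarLogData_wide : IsScalarLogData pc qc p q (5 / 4) 30 (4 / 5) where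
  a_pos := by norm_num
  K_nonneg := by norm_num
  ρ₀_pos := by norm_num
  norm_pc_le k _ := (norm_pc_le_one k).trans (by
    have h1 : (1 : ℝ) ≤ (5 / 4) ^ k := one_le_pow₀ (by norm_num)
    nlinarith)
  norm_qc_le k _ := norm_qc_le_sharp k
  pc_zero := pc_zero
  hasSum_p x hx := by
    have hx1 : ‖x‖ < 1 := hx.trans (by norm_num)
    -- `p(x) = x/(1+x) = Σ_{n≥1} (−1)^{n+1} xⁿ`
    have hg : HasSum (fun n : ℕ => (-x) ^ n) (1 - -x)⁻¹ := hasSum_geometric_of_norm_lt_one (by rwa [norm_neg])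
    have h2 := hg.mul_left (-1 : ℝ)
    have h3 : HasSum (fun n : ℕ => if n = 0 then (1 : ℝ) else 0) 1 := hasSum_ite_eq 0 1
    have h4 := h2.add h3
    have ev : -1 * (1 - -x)⁻¹ + 1 = p x := by
      obtain ⟨hxa, -⟩ := one_add_ne_zero_of_lt hx
      rw [p, sub_neg_eq_add]
      field_simp
      ring
    rw [ev] at h4
    have ef : (fun n : ℕ => x ^ n * pc n) = fun n : ℕ => -1 * (-x) ^ n + if n = 0 then (1 : ℝ) else 0 := by
      funext n
      rcases n with _ | n
      · simp [pc_val_0]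
      · rw [pc_succ, neg_pow x, pow_succ (-1 : ℝ) n]
        simp only [Nat.succ_ne_zero, if_false, add_zero]
        ring
    rw [ef]
    exact h4
  hasSum_q x hx := by
    have hx1 : ‖x‖ < 1 := hx.trans (by norm_num)
    obtain ⟨hxa, hxb⟩ := one_add_ne_zero_of_lt hx
    have h := (hasSum_geomPart hx1).add (hasSum_ec hx)
    rw [← q_partial_fractions hxa hxb] at h
    have ef : (fun k : ℕ => x ^ k * qc k) =
        fun k : ℕ => x ^ k * (4 * (k : ℝ) * (-1) ^ k - 14 / 5 * (-1 / 2) ^ k) + x ^ k * ec k := by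
      funext k; rw [qc_decomp k]; ring
    rw [ef]
    exact h

/-- Linear growth against the geometric rate `13/10`: `4(20 + j) + 19/5 ≤ (1/2)(13/10)^{20+j}`. [folklore] -/
theorem lin_le_geom_aux (j : ℕ) : 4 * ((20 + j : ℕ) : ℝ) + 19 / 5 ≤ 1 / 2 * (13 / 10 : ℝ) ^ (20 + j) := by
  induction j with
  | zero => norm_num
  | succ i ih =>
    have hbase : (190 : ℝ) ≤ (13 / 10 : ℝ) ^ (20 + i) :=
      le_trans (by norm_num) (pow_le_pow_right₀ (by norm_num : (1 : ℝ) ≤ 13 / 10) (by omega : 20 ≤ 20 + i))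
    rw [show 20 + (i + 1) = (20 + i) + 1 by omega, pow_succ]
    push_cast at ih ⊢
    linarith

/-- **THE HYBRID OPERATOR BOUND** `‖M_k‖ ≤ (611/100)·(13/10)ᵏ` for `k ≥ 1`: the exact values of `|qc k| + |pc k|` for
`k < 20` (the supremum `6.10…` is attained at `k = 3, 4`) and the structure `4k + 14/5·2⁻ᵏ + 11·(5/4)ᵏ + 1` beyond.
This is the constant that enters the jet lemma; with the crude `2K + a⁻¹` it would be `≈ 60`. [instance data] -/
theorem norm_Msys_le_sharp (k : ℕ) (hk : 1 ≤ k) : ‖Msys k‖ ≤ 611 / 100 * (13 / 10 : ℝ) ^ k := by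
  refine (norm_scalarSysM_le pc qc k).trans ?_
  rcases lt_or_ge k 20 with hlt | hge
  · interval_cases k
    · rw [qc_val_1, pc_val_1]; norm_num
    · rw [qc_val_2, pc_val_2]; norm_num
    · rw [qc_val_3, pc_val_3]; norm_num
    · rw [qc_val_4, pc_val_4]; norm_num
    · rw [qc_val_5, pc_val_5]; norm_num
    · rw [qc_val_6, pc_val_6]; norm_num
    · rw [qc_val_7, pc_val_7]; norm_num
    · rw [qc_val_8, pc_val_8]; norm_num
    · rw [qc_val_9, pc_val_9]; norm_num
    · rw [qc_val_10, pc_val_10]; norm_num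
    · rw [qc_val_11, pc_val_11]; norm_num
    · rw [qc_val_12, pc_val_12]; norm_num
    · rw [qc_val_13, pc_val_13]; norm_num
    · rw [qc_val_14, pc_val_14]; norm_num
    · rw [qc_val_15, pc_val_15]; norm_num
    · rw [qc_val_16, pc_val_16]; norm_num
    · rw [qc_val_17, pc_val_17]; norm_num
    · rw [qc_val_18, pc_val_18]; norm_num
    · rw [qc_val_19, pc_val_19]; norm_num
  · have hk1 : k ≠ 1 := by omega
    rw [if_neg hk1]
    obtain ⟨j, rfl⟩ : ∃ j, k = 20 + j := ⟨k - 20, by omega⟩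
    have hp := norm_pc_le_one (20 + j)
    -- structure of `qc`
    have hq : ‖qc (20 + j)‖ ≤ 4 * ((20 + j : ℕ) : ℝ) + 14 / 5 * (1 / 2) ^ (20 + j) + 11 * (5 / 4) ^ (20 + j) := by
      rw [qc_decomp]
      calc ‖4 * ((20 + j : ℕ) : ℝ) * (-1) ^ (20 + j) - 14 / 5 * (-1 / 2) ^ (20 + j) + ec (20 + j)‖
          ≤ ‖4 * ((20 + j : ℕ) : ℝ) * (-1) ^ (20 + j)‖ + ‖14 / 5 * (-1 / 2 : ℝ) ^ (20 + j)‖ + ‖ec (20 + j)‖ :=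
            norm_sub_add_le₃ _ _ _
        _ ≤ 4 * ((20 + j : ℕ) : ℝ) + 14 / 5 * (1 / 2) ^ (20 + j) + 11 * (5 / 4) ^ (20 + j) := by
            refine add_le_add (add_le_add (le_of_eq ?_) (le_of_eq ?_)) (norm_ec_le _)
            · rw [norm_mul, norm_mul, norm_pow, norm_neg, norm_one, one_pow, mul_one, Real.norm_ofNat,
                Real.norm_natCast]
            · rw [norm_mul, norm_pow, Real.norm_of_nonneg (by norm_num : (0 : ℝ) ≤ 14 / 5), norm_div, norm_neg,
                norm_one, Real.norm_ofNat]
    -- the three pieces against `(13/10)^(20+j)`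
    have hA : 4 * ((20 + j : ℕ) : ℝ) + 14 / 5 * (1 / 2) ^ (20 + j) + 1 ≤ 1 / 2 * (13 / 10 : ℝ) ^ (20 + j) := by
      have hhalf : (1 / 2 : ℝ) ^ (20 + j) ≤ 1 := pow_le_one₀ (by norm_num) (by norm_num)
      have H := lin_le_geom_aux j
      nlinarith
    have hB : 11 * (5 / 4 : ℝ) ^ (20 + j) ≤ 28 / 5 * (13 / 10 : ℝ) ^ (20 + j) := by
      rw [pow_add, pow_add]
      have h1 : 11 * (5 / 4 : ℝ) ^ 20 ≤ 28 / 5 * (13 / 10 : ℝ) ^ 20 := by norm_num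
      have h2 : (5 / 4 : ℝ) ^ j ≤ (13 / 10 : ℝ) ^ j := pow_le_pow_left₀ (by norm_num) (by norm_num) j
      have h3 : (0 : ℝ) ≤ (5 / 4 : ℝ) ^ j := by positivity
      have h4 : (0 : ℝ) ≤ (13 / 10 : ℝ) ^ 20 := by positivity
      nlinarith [mul_le_mul h1 h2 h3 (by positivity)]
    calc max 0 (‖qc (20 + j)‖ + ‖pc (20 + j)‖)
        ≤ 4 * ((20 + j : ℕ) : ℝ) + 14 / 5 * (1 / 2) ^ (20 + j) + 11 * (5 / 4) ^ (20 + j) + 1 := by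
          refine max_le (by positivity) ?_
          linarith
      _ ≤ 611 / 100 * (13 / 10 : ℝ) ^ (20 + j) := by
          have hT : (0 : ℝ) ≤ (13 / 10 : ℝ) ^ (20 + j) := by positivity
          linarith

end TearingFRS1

end Summit.Ventures.FusionMHD.Models

end
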